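import Summits.FinalStateConjecture.FinalStateConjecture.Theses.EIHFluxBalance
import Summits.FinalStateConjecture.FinalStateConjecture.Theorems.EIHFluxBalanceLLBalanceLawMomentum
import Summits.FinalStateConjecture.FinalStateConjecture.Theorems.EIHFluxBalanceLLShellFormula

/-!
# Route EIHFluxBalance — `LLBalanceLaw`: assembly of the five clauses

Closing file for the support item `stmt-FinalStateConjecture-10189`
(`Summit.FinalStateConjecture.FinalStateConjecture.Theses.EIHFluxBalance.LLBalanceLaw`): the
conjunction of

* (i)–(iii) the pointwise identities `LLBalance.llBalanceLaw_pointwise` (LL (96.5)–(96.10) as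
  identities of the definitions; Schwarz on the antisymmetric superpotential; `G^{μν} = 0` in vacuum);
* (iv) the balance law `LLBalance.hasDerivAt_quasiLocalMomentum` (LL (96.16): differentiation under
  the surface integral, the vacuum identity for `∂₀ h^{μ0j}`, and the vanishing flux of the
  antisymmetric `Σ_l ∂_l h^{μjl}` through the closed sphere);
* (v) the spherical shell formula `LLSphere.llBalanceLaw_shell` for the Euclidean Hausdorff surface
  measure `μHE[2]`.
-/

noncomputable section

namespace Summit.FinalStateConjecture.FinalStateConjecture.Theorems

namespace LLBalance

open Literature.Geometry.Lorentzian Literature.Geometry.Lorentzian.LandauLifshitz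

/-- **`LLBalanceLaw` holds** (support item of route EIHFluxBalance, Landau–Lifshitz §96): clauses
(i)–(iii) from `llBalanceLaw_pointwise`, (iv) from `hasDerivAt_quasiLocalMomentum` (with
`det g ≠ 0` from `det g < 0`), (v) from `LLSphere.llBalanceLaw_shell`.
[cite: LandauLifshitz1975, §96] -/
theorem llBalanceLaw_assembled :
    Summit.FinalStateConjecture.FinalStateConjecture.Theses.EIHFluxBalance.LLBalanceLaw := by
  unfold Summit.FinalStateConjecture.FinalStateConjecture.Theses.EIHFluxBalance.LLBalanceLaw
  intro g U hU hg _ hdet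
  obtain ⟨h1, h2, h3⟩ := llBalanceLaw_pointwise g U hU hg hdet
  exact ⟨h1, h2, h3, fun t R ξ _ hsph hric μ ↦ hasDerivAt_quasiLocalMomentum hU hg
    (fun x hx ↦ (hdet x hx).ne) hric hsph μ, LLSphere.llBalanceLaw_shell⟩

end LLBalance

end Summit.FinalStateConjecture.FinalStateConjecture.Theorems

end
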